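import Summits.QuantumFields.GaugeBoot.DiagonalRPTorusPolyakovLadder
import HarnessLib

/-!
# Covering columns by plaquettes; the centre-twist vanishing lemma (gauge-boot, task L3(ξ))

HONEST FRAMING (cell `pub-gaugeboot`, page 1 of every file): the venture produces certified bounds
on lattice expectations at stated coupling, gauge group, dimension and torus size; NOT a mass gap,
NOT a continuum limit, NOT a string tension; NOT Yang–Mills-summit-bearing (barriers
`FixedCouplingUltralocality`, `PerturbativeInvisibility`). This module is combinatorial and
measure-theoretic bookkeeping for the structural NEGATIVE result `DiagonalRPTorusNegativeOddSUN`
(closed-half diagonal RP fails on odd three-tori for `G ≅ SU(N)` at small coupling); it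
discharges nothing by itself.

## Content (torus `(ℤ/L)³`, spectator direction `2`)

* `Covers S B` — every vertical link over the column `B` lies in a plaquette of `S`;
* counting: `le_card_of_covers` (`|S| ≥ L`), `two_mul_le_card_of_covers` (`|S| ≥ 2L` when the two
  covered columns differ in both coordinates: the `2L` column links sit in distinct plaquettes,
  `DiagRPThree.eq_of_mem_colLinks_of_pcnt_ne_zero`), `eq_ladder_of_covers` (two ADJACENT columns
  covered by at most `L` plaquettes force the rung ladder, `L ≥ 3`);
* **`pairTerm_eq_zero_of_not_covers`** — the CENTRE-TWIST VANISHING LEMMA: if `ρ z₀ = ω • 1`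
  with `ω ≠ 1` and a vertical link of the column `B` lies in no plaquette of `S`, then
  `∫ P_A(U) P_B(U) ∏_{p ∈ S} g_p(U) ∏ dU = 0` for every column `A ≠ B` and all real plaquette
  functionals `g_p(U) = f(Re tr ρ(U_p))`: multiplying that link variable by `z₀` preserves the
  product Haar measure, fixes `P_A` and every `g_p`, and multiplies the complex Polyakov loop
  `tr ρ(𝔅)` by `ω`.

Elementary; no named fact.
-/

open MeasureTheory Complex Finset Function
open scoped ComplexOrder

namespace Summit.QuantumFields.GaugeBoot

open Literature.MathematicalPhysics.QuantumFieldTheory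
open Literature.MathematicalPhysics.QuantumFieldTheory.PlaquetteLowerBound (reTr)
open Literature.RepresentationTheory.CompactGroups

noncomputable section

namespace DiagRPSUN

open DiagRPThree DiagRPPolyakov

/-! ## Covering a column -/

section Cover

variable {L : ℕ}

/-- `S` COVERS the column `B`: every vertical link `(vsite B z, 2)` lies in a plaquette of `S`.
[shape] A parametric definition of a predicate — NOT a fact. [folklore] -/
def Covers (S : Finset (Plaquette 3 L)) (B : ZMod L × ZMod L) : Prop :=
  ∀ z : ZMod L, ∃ p ∈ S, pcnt p (vsite B z, 2) ≠ 0

/-- A link not counted by `pcnt` is none of the four links of the plaquette. -/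
theorem links_ne_of_pcnt_eq_zero {p : Plaquette 3 L} {e : Edge 3 L} (h : pcnt p e = 0) :
    (p.1, p.2.1.1) ≠ e ∧ (p.1.shift p.2.1.1, p.2.1.2) ≠ e ∧ (p.1.shift p.2.1.2, p.2.1.1) ≠ e ∧
      (p.1, p.2.1.2) ≠ e := by
  unfold pcnt at h
  refine ⟨fun h1 => ?_, fun h2 => ?_, fun h3 => ?_, fun h4 => ?_⟩
  · rw [if_pos h1] at h; omega
  · rw [if_pos h2] at h; omega
  · rw [if_pos h3] at h; omega
  · rw [if_pos h4] at h; omega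

/-- The horizontal direction of a plaquette is not the spectator direction. -/
theorem plaq_fst_ne_two (p : Plaquette 3 L) : p.2.1.1 ≠ 2 := fun h2 => by
  have h := p.2.2
  rw [h2] at h
  exact absurd h (not_lt.2 (Fin.le_last _))

/-- A plaquette containing a vertical link is based at the height of that link. -/
theorem height_eq_of_pcnt_ne_zero {p : Plaquette 3 L} {B : ZMod L × ZMod L} {z : ZMod L}
    (h : pcnt p (vsite B z, 2) ≠ 0) : p.1 2 = z := by
  rcases vertical_link h with hy | hy
  · rw [← hy, vsite_two]
  · have h2 : (p.1.shift p.2.1.1) 2 = p.1 2 := WilsonRP.shift_apply_of_ne _ (plaq_fst_ne_two p).symm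
    rw [← h2, ← hy, vsite_two]

/-- A plaquette containing a vertical link is a vertical plaquette (`plane = (a, 2)`), and the
link is one of its two vertical links. -/
theorem vertical_of_pcnt_ne_zero {p : Plaquette 3 L} {y : Site 3 L} (h : pcnt p (y, 2) ≠ 0) :
    p.2.1.2 = 2 ∧ (y = p.1.shift p.2.1.1 ∨ y = p.1) := by
  have hi := plaq_fst_ne_two p
  have hmem := mem_linkList_of_pcnt_ne_zero h
  unfold linkList at hmem
  simp only [List.mem_cons, List.not_mem_nil, or_false, Prod.mk.injEq] at hmem
  rcases hmem with ⟨_, h2⟩ | ⟨h1, h2⟩ | ⟨_, h2⟩ | ⟨h1, h2⟩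
  · exact absurd h2.symm hi
  · exact ⟨h2.symm, Or.inl h1⟩
  · exact absurd h2.symm hi
  · exact ⟨h2.symm, Or.inr h1⟩

variable [NeZero L]

/-- **Covering one column costs `L` plaquettes** (one per height). -/
theorem le_card_of_covers {S : Finset (Plaquette 3 L)} {B : ZMod L × ZMod L} (h : Covers S B) :
    L ≤ S.card := by
  classical
  choose f hfS hf using h
  have hinj : Function.Injective f := fun z w hzw => by
    have hz := height_eq_of_pcnt_ne_zero (hf z)
    have hw := height_eq_of_pcnt_ne_zero (hf w)
    rw [hzw] at hz
    exact hz.symm.trans hw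
  calc L = (univ.image f).card := by rw [card_image_of_injective _ hinj, card_univ, ZMod.card]
    _ ≤ S.card := card_le_card (image_subset_iff.2 fun z _ => hfS z)

/-- **Covering two columns that differ in both coordinates costs `2L` plaquettes**: the `2L`
column links lie in pairwise distinct plaquettes. -/
theorem two_mul_le_card_of_covers {S : Finset (Plaquette 3 L)} {A B : ZMod L × ZMod L}
    (h0 : A.1 ≠ B.1) (h1 : A.2 ≠ B.2) (hA : Covers S A) (hB : Covers S B) : 2 * L ≤ S.card := by
  classical
  have key : ∀ k : Edge 3 L, ∃ p : Plaquette 3 L,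
      k ∈ colLinks A ∪ colLinks B → p ∈ S ∧ pcnt p k ≠ 0 := by
    intro k
    by_cases hk : k ∈ colLinks A ∪ colLinks B
    · obtain ⟨h2, hcol⟩ := col_of_mem_union hk
      have hkA : ∀ C : ZMod L × ZMod L, k.1 0 = C.1 ∧ k.1 1 = C.2 → k = (vsite C (k.1 2), 2) :=
        fun C hC => Prod.ext (eq_vsite_iff.2 ⟨hC, rfl⟩) h2
      rcases hcol with hcA | hcB
      · obtain ⟨p, hpS, hp⟩ := hA (k.1 2)
        exact ⟨p, fun _ => ⟨hpS, by rwa [hkA A hcA]⟩⟩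
      · obtain ⟨p, hpS, hp⟩ := hB (k.1 2)
        exact ⟨p, fun _ => ⟨hpS, by rwa [hkA B hcB]⟩⟩
    · exact ⟨(vsite A 0, plane02), fun h => absurd h hk⟩
  choose g hg using key
  rw [← card_union_colLinks h0]
  refine card_le_card_of_injOn g (fun k hk => (hg k hk).1) fun k₁ hk₁ k₂ hk₂ h => ?_
  exact eq_of_mem_colLinks_of_pcnt_ne_zero h0 h1 hk₁ hk₂ (hg k₁ hk₁).2 (h ▸ (hg k₂ hk₂).2)

omit [NeZero L] in
/-- Nearest-neighbour columns in the directions `i ≠ a` (both horizontal) differ. -/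
theorem bump_eq_bump_iff (hL : 1 < L) {i a : Fin 3} (hi : i ≠ 2) (ha : a ≠ 2)
    (B : ZMod L × ZMod L) : bump i B = bump a B ↔ i = a := by
  have h1 : (1 : ZMod L) ≠ 0 := fun h => by
    have := (ZMod.val_eq_zero (1 : ZMod L)).2 h
    rw [ZMod.val_one'' hL.ne'] at this
    exact one_ne_zero this
  refine ⟨fun h => ?_, fun h => by rw [h]⟩
  by_contra hia
  unfold bump at h
  have e0 := congrArg Prod.fst h
  have e1 := congrArg Prod.snd h
  simp only [add_right_inj] at e0 e1
  fin_cases i <;> fin_cases a <;> simp_all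

omit [NeZero L] in
/-- Two steps never return: `bump i (bump a B) ≠ B` for horizontal `i, a` and `L ≥ 3`. -/
theorem bump_bump_ne (hL : 3 ≤ L) {i a : Fin 3} (hi : i ≠ 2) (ha : a ≠ 2)
    (B : ZMod L × ZMod L) : bump i (bump a B) ≠ B := by
  have h1 : (1 : ZMod L) ≠ 0 := fun h => by
    have := (ZMod.val_eq_zero (1 : ZMod L)).2 h
    rw [ZMod.val_one'' (by omega)] at this
    exact one_ne_zero this
  have h2 : (1 : ZMod L) + 1 ≠ 0 := fun h => by
    have h' : ((2 : ℕ) : ZMod L) = 0 := by rw [Nat.cast_two, ← one_add_one_eq_two]; exact h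
    rw [ZMod.natCast_eq_zero_iff] at h'
    have := Nat.le_of_dvd two_pos h'
    omega
  intro h
  unfold bump at h
  have e0 := congrArg Prod.fst h
  have e1 := congrArg Prod.snd h
  simp only [add_assoc, add_eq_left] at e0 e1
  fin_cases i <;> fin_cases a <;> simp_all

omit [NeZero L] in
/-- **The rung is forced**: a plaquette containing the vertical links over `B` AND over
`B + e_a` at height `z` is the rung plaquette `(vsite B z, (a, 2))` (`L ≥ 3`). -/
theorem eq_rung_of_pcnt (hL : 3 ≤ L) (pl : {q : Fin 3 × Fin 3 // q.1 < q.2}) (hpl : pl.1.2 = 2)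
    (B : ZMod L × ZMod L) {p : Plaquette 3 L} {z : ZMod L}
    (hB : pcnt p (vsite B z, 2) ≠ 0) (hA : pcnt p (vsite (bump pl.1.1 B) z, 2) ≠ 0) :
    p = (vsite B z, pl) := by
  have ha := fst_ne_two pl hpl
  have hi := plaq_fst_ne_two p
  obtain ⟨hj, hBy⟩ := vertical_of_pcnt_ne_zero hB
  obtain ⟨-, hAy⟩ := vertical_of_pcnt_ne_zero hA
  have hAB : bump pl.1.1 B ≠ B := bump_ne_self (by omega) ha B
  -- the plane of `p` is `(i, 2)`; compare with `pl = (a, 2)`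
  have hplane : ∀ {i : Fin 3}, i = pl.1.1 → p.2.1.1 = i → p.2 = pl := fun hia hpi => by
    apply Subtype.ext
    exact Prod.ext (hpi.trans hia) (hj.trans hpl.symm)
  rcases hBy with hBy | hBy <;> rcases hAy with hAy | hAy
  · exact absurd (vsite_eq_vsite_iff.1 (hAy.trans hBy.symm)).1 hAB
  · -- `B` over `x + e_i`, `A` over `x`: two steps return — impossible
    exfalso
    have h := hBy
    rw [← hAy, vsite_shift_of_ne_two _ z hi] at h
    exact bump_bump_ne hL hi ha B (vsite_eq_vsite_iff.1 h).1.symm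
  · -- `B` over `x`, `A` over `x + e_i`: the rung, `i = a`
    have h := hAy
    rw [← hBy, vsite_shift_of_ne_two _ z hi] at h
    have hia : p.2.1.1 = pl.1.1 :=
      (bump_eq_bump_iff (by omega) hi ha B).1 (vsite_eq_vsite_iff.1 h).1.symm
    exact Prod.ext hBy.symm (hplane rfl hia)
  · exact absurd (vsite_eq_vsite_iff.1 (hAy.trans hBy.symm)).1 hAB

/-- **Adjacent columns covered by at most `L` plaquettes force the ladder** (`L ≥ 3`). -/
theorem eq_ladder_of_covers (hL : 3 ≤ L) (pl : {q : Fin 3 × Fin 3 // q.1 < q.2})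
    (hpl : pl.1.2 = 2) (B : ZMod L × ZMod L) {S : Finset (Plaquette 3 L)}
    (hA : Covers S (bump pl.1.1 B)) (hB : Covers S B) (hcard : S.card ≤ L) : S = ladder B pl := by
  classical
  choose f hfS hf using hB
  have hinj : Function.Injective f := fun z w hzw => by
    have hz := height_eq_of_pcnt_ne_zero (hf z)
    have hw := height_eq_of_pcnt_ne_zero (hf w)
    rw [hzw] at hz
    exact hz.symm.trans hw
  have himg : univ.image f = S := by
    refine eq_of_subset_of_card_le (image_subset_iff.2 fun z _ => hfS z) ?_
    rw [card_image_of_injective _ hinj, card_univ, ZMod.card]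
    exact hcard
  have hfz : ∀ z, f z = (vsite B z, pl) := by
    intro z
    obtain ⟨q, hqS, hq⟩ := hA z
    rw [← himg, mem_image] at hqS
    obtain ⟨w, -, rfl⟩ := hqS
    have hwz : w = z := (height_eq_of_pcnt_ne_zero (hf w)).symm.trans (height_eq_of_pcnt_ne_zero hq)
    subst hwz
    exact eq_rung_of_pcnt hL pl hpl B (hf w) hq
  rw [← himg]
  unfold ladder
  exact image_congr fun z _ => hfz z

omit [NeZero L] in
/-- Not covering means some vertical link of the column lies in no plaquette of `S`. -/
theorem exists_height_of_not_covers {S : Finset (Plaquette 3 L)} {B : ZMod L × ZMod L}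
    (h : ¬ Covers S B) : ∃ z : ZMod L, ∀ p ∈ S, pcnt p (vsite B z, 2) = 0 := by
  unfold Covers at h
  obtain ⟨z, hz⟩ := not_forall.1 h
  refine ⟨z, fun p hp => ?_⟩
  by_contra hne
  exact hz ⟨p, hp, hne⟩

end Cover

/-! ## The centre-twist vanishing lemma -/

section Twist

variable {L : ℕ} [NeZero L] {N : ℕ} {G : Type*} [Group G] [TopologicalSpace G]
  [IsTopologicalGroup G] [CompactSpace G] [MeasurableSpace G] [BorelSpace G]
  [SecondCountableTopology G] (ρ : G →* Matrix (Fin N) (Fin N) ℂ)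

omit [TopologicalSpace G] [IsTopologicalGroup G] [CompactSpace G] [MeasurableSpace G] [BorelSpace G]
  [SecondCountableTopology G] in
/-- **Twisting one link of a Polyakov loop.** Multiplying the vertical link at height `z` over
`B` on the left by `z₀` with `ρ z₀ = ω • 1` multiplies `ρ` of the Polyakov holonomy by `ω`. -/
theorem map_colHol_update_mul (B : ZMod L × ZMod L) (z : ZMod L) {z₀ : G} {ω : ℂ}
    (hz₀ : ρ z₀ = ω • (1 : Matrix (Fin N) (Fin N) ℂ)) (U : GaugeConfig 3 L G) :
    ρ (lineHolonomy (update U (vsite B z, 2) (z₀ * U (vsite B z, 2))) 2 L (vsite B 0)) =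
      ω • ρ (lineHolonomy U 2 L (vsite B 0)) := by
  set e : Edge 3 L := (vsite B z, 2) with he
  have hzL : z.val < L := ZMod.val_lt z
  -- split the column at height `z`: heights `< z`, the link `e`, heights `> z`
  have hsplit : ∀ V : GaugeConfig 3 L G, lineHolonomy V 2 L (vsite B 0) =
      lineHolonomy V 2 z.val (vsite B 0) *
        (V e * lineHolonomy V 2 (L - z.val - 1) (vsite B (z + 1))) := by
    intro V
    have h := WilsonLoopRP.lineHolonomy_add V 2 z.val (L - z.val) (vsite B 0)
    rw [Nat.add_sub_cancel' hzL.le] at h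
    rw [h, vsite_add_single_two, zero_add, ZMod.natCast_zmod_val,
      lineHolonomy_eq_mul V 2 (by omega : 0 < L - z.val), vsite_shift_two, he]
  have hlow : lineHolonomy (update U e (z₀ * U e)) 2 z.val (vsite B 0) =
      lineHolonomy U 2 z.val (vsite B 0) := by
    refine lineHolonomy_update_of_ne B 0 z.val fun t ht h => ?_
    have h2 : (0 : ZMod L) + (t : ZMod L) = z := (vsite_eq_vsite_iff.1 (congrArg Prod.fst h)).2
    rw [zero_add, ← ZMod.natCast_zmod_val z] at h2
    have := (natCast_eq_natCast_iff_of_lt (by omega) hzL).1 h2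
    omega
  have hup : lineHolonomy (update U e (z₀ * U e)) 2 (L - z.val - 1) (vsite B (z + 1)) =
      lineHolonomy U 2 (L - z.val - 1) (vsite B (z + 1)) := by
    refine lineHolonomy_update_of_ne B (z + 1) (L - z.val - 1) fun t ht h => ?_
    have h2 : z + 1 + (t : ZMod L) = z := (vsite_eq_vsite_iff.1 (congrArg Prod.fst h)).2
    have h3 : (((t + 1 : ℕ)) : ZMod L) = ((0 : ℕ) : ZMod L) := by
      push_cast
      linear_combination h2
    have := (natCast_eq_natCast_iff_of_lt (by omega) (NeZero.pos L)).1 h3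
    omega
  rw [hsplit, hsplit U, hlow, hup, update_self, map_mul, map_mul, map_mul, hz₀, map_mul, map_mul]
  rw [smul_mul_assoc, one_mul, Matrix.smul_mul, Matrix.mul_smul]

/-- **The centre-twist vanishing lemma.** Let `ρ z₀ = ω • 1` with `ω ≠ 1`, let `A ≠ B` be
columns and let the vertical link at height `z` over `B` lie in no plaquette of `S`. Then for
every family of real plaquette functionals `g p U = f p (Re tr ρ(U_p))`,
`∫ P_A P_B ∏_{p ∈ S} g_p ∏ dU = 0`. -/
theorem integral_polRe_mul_polRe_mul_prod_eq_zero (hρ : Continuous ρ) {z₀ : G} {ω : ℂ}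
    (hz₀ : ρ z₀ = ω • (1 : Matrix (Fin N) (Fin N) ℂ)) (hω : ω ≠ 1) {A B : ZMod L × ZMod L}
    (hAB : A ≠ B) (S : Finset (Plaquette 3 L)) {z : ZMod L}
    (hz : ∀ p ∈ S, pcnt p (vsite B z, 2) = 0) (f : Plaquette 3 L → ℝ → ℝ)
    (hf : ∀ p, Continuous (f p)) :
    ∫ U, polRe ρ 2 U (vsite A 0) * polRe ρ 2 U (vsite B 0) *
        ∏ p ∈ S, f p (WilsonRP.plaqRe ρ U p) ∂Measure.pi (fun _ : Edge 3 L => haarProbability G)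
      = 0 := by
  set e : Edge 3 L := (vsite B z, 2) with he
  -- the complex integrand with the complex Polyakov loop `tr ρ(𝔅)`
  set Fc : GaugeConfig 3 L G → ℂ := fun U => (polRe ρ 2 U (vsite A 0) : ℂ) *
    (ρ (lineHolonomy U 2 L (vsite B 0))).trace * ((∏ p ∈ S, f p (WilsonRP.plaqRe ρ U p) : ℝ) : ℂ)
    with hFc
  have hFc_cont : Continuous Fc :=
    ((Complex.continuous_ofReal.comp (continuous_polRe ρ hρ 2 _)).mul
      (hρ.matrix_trace.comp (continuous_lineHolonomy 2 L _))).mul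
      (Complex.continuous_ofReal.comp (continuous_finsetProd _ fun p _ =>
        (hf p).comp (continuous_plaqRe ρ hρ p)))
  -- twisting the link `e`: `Fc ∘ τ = ω Fc`
  have htwist : ∀ U, Fc (update U e (z₀ * U e)) = ω * Fc U := by
    intro U
    have hA : polRe ρ 2 (update U e (z₀ * U e)) (vsite A 0) = polRe ρ 2 U (vsite A 0) := by
      unfold polRe
      rw [lineHolonomy_update_of_col_ne hAB]
    have hS : ∏ p ∈ S, f p (WilsonRP.plaqRe ρ (update U e (z₀ * U e)) p) =
        ∏ p ∈ S, f p (WilsonRP.plaqRe ρ U p) := by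
      refine prod_congr rfl fun p hp => ?_
      obtain ⟨h1, h2, h3, h4⟩ := links_ne_of_pcnt_eq_zero (hz p hp)
      rw [plaqRe_update_of_ne ρ p h1 h2 h3 h4]
    have hcolB : (ρ (lineHolonomy (update U e (z₀ * U e)) 2 L (vsite B 0))).trace =
        ω * (ρ (lineHolonomy U 2 L (vsite B 0))).trace := by
      have h := map_colHol_update_mul ρ B z hz₀ U
      rw [← he] at h
      rw [h, Matrix.trace_smul, smul_eq_mul]
    simp only [hFc, hA, hS, hcolB]
    ring
  -- hence `∫ Fc = ω ∫ Fc`, so `∫ Fc = 0`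
  have hint : ∫ U, Fc U ∂Measure.pi (fun _ : Edge 3 L => haarProbability G) = 0 := by
    have h := integral_update_mul_left (G := G) e z₀ hFc_cont.measurable
    simp_rw [htwist] at h
    rw [integral_const_mul] at h
    have h2 : (ω - 1) * ∫ U, Fc U ∂Measure.pi (fun _ : Edge 3 L => haarProbability G) = 0 := by
      rw [sub_mul, one_mul, h, sub_self]
    rcases mul_eq_zero.1 h2 with h3 | h3
    · exact absurd (sub_eq_zero.1 h3) hω
    · exact h3
  -- and the real integrand is `Re Fc`
  have hre : ∀ U, polRe ρ 2 U (vsite A 0) * polRe ρ 2 U (vsite B 0) *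
      ∏ p ∈ S, f p (WilsonRP.plaqRe ρ U p) = (Fc U).re := by
    intro U
    simp only [hFc, Complex.mul_re, Complex.ofReal_re, Complex.ofReal_im, zero_mul, sub_zero,
      mul_zero]
    unfold polRe
    ring
  simp_rw [hre]
  have h := integral_re (𝕜 := ℂ) (integrable_of_continuous_config hFc_cont)
  simp only [RCLike.re_to_complex] at h
  rw [h, hint, Complex.zero_re]

end Twist

end DiagRPSUN

end

end Summit.QuantumFields.GaugeBoot
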